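import Literature.Geometry.Riemannian.GaussBonnetGradient
import Literature.Geometry.Manifold.CompleteFlow
import Literature.Geometry.Manifold.TimeDependentIntegralCurve
import Literature.Geometry.Riemannian.RicciFlow
import Literature.Geometry.Riemannian.RicciFlowMaximal
import Literature.Geometry.Riemannian.RicciFlowMaximalScaling
import Literature.Geometry.Riemannian.MetricTraceScaling
import Literature.Geometry.Riemannian.PullbackFamilyDerivative
import Literature.Geometry.Riemannian.AlmostNonnegativeCurvatureSmoothingProofs
import Literature.Geometry.Lorentzian.Isometry
import Literature.Geometry.Lorentzian.IsometryProofs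
import Literature.Geometry.Lorentzian.CurvatureNaturality
import Literature.Geometry.Lorentzian.HypersurfaceHessian
import Literature.Geometry.Lorentzian.LeviCivitaProofs
import HarnessLib

/-!
# Helper `helper_shrinkerCanonicalFlow_of` of line `collapsed-ends-usc` (crux
# `EntropyRung.NoncompactShrinkerGap`, stmt-SmoothPoincare4-10868): the canonical ancient Ricci flow
# of a gradient shrinking soliton

Registered helper stub (brick 3b of the printed chain of route item 16588,
`shrinkerSplittingAtInfinity_four`): a gradient shrinking Ricci soliton `(M, g, f)`,
`Ric + Hess f = g/2`, together with the global flow `θ` of `∇f`, generates the self-similar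
**ancient** Ricci flow `g(t) = (1 − t) ψ_t^* g`, `t < 1`, `ψ_t = θ(−log(1 − t), ·)`
(`∂_t ψ_t = (1 − t)⁻¹ ∇f ∘ ψ_t`, `ψ_0 = id`), and this flow is of **Type I**:
`|Rm_{g(t)}| ≤ C/(1 − t)` as soon as `|Rm_g| ≤ C` (Naber 2010, Lemma 1.1; Chow–Lu–Ni 2006,
Thm. 4.1; Topping 2006, §1.2.2, Prop. 1.2.1 for the computation
`∂_t (ψ_t^* g) = ψ_t^*(ℒ_{X_t} g)`, `ℒ_{∇f} g = 2 Hess f`).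

Contents (everything proved, no definitions, no named facts):

* `isTimeDepMIntegralCurveOn_log_reparam` — an integral curve `γ` of `V` reparametrised by
  `t ↦ −log(1 − t)` is an integral curve of the time-dependent field `(1 − t)⁻¹ V` on `(−∞, 1)`;
* `injective_mfderiv_flow_slice`, `contMDiffOn_flow_log` — the time-`c` maps of a smooth global
  flow have injective differentials; `(x, t) ↦ θ(−log(1 − t), x)` is smooth on `M × (−∞, 1)`;
* `lieDerivMetric_smul_grad` — `ℒ_{c ∇f} g = 2c Hess f` through the Levi-Civita connection;
* `curvatureBoundedBy_comap_leviCivita` — pullbacks along local diffeomorphisms keep frame-wise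
  curvature bounds (O'Neill 1983, Prop. 3.59; the tree's `curvatureForm_comap_leviCivita`);
* `exists_isRicciFlow_shrinker_pullback` — the flow `(1 − t) ψ_t^* g` for an abstract family `ψ`
  generated by `(1 − t)⁻¹ ∇f`: `IsRicciFlow` on `Iio 1`, Riemannian, Ricci/scalar naturality,
  Type I;
* `helper_shrinkerCanonicalFlow_of` — the registered signature, with `ψ_t = θ(−log(1 − t), ·)`.

## References

* [Naber2010] A. Naber, *Noncompact shrinking four solitons with nonnegative curvature*,
  J. reine angew. Math. 645 (2010), Lemma 1.1.
* B. Chow, P. Lu, L. Ni, *Hamilton's Ricci flow*, GSM 77 (2006), Thm. 4.1 (canonical form of a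
  gradient soliton).
* [Topping2006] P. Topping, *Lectures on the Ricci flow* (2006), §1.2.2, Prop. 1.2.1; §1.2.3.
* [ONeill1983] B. O'Neill, *Semi-Riemannian geometry* (1983), Ch. 3, p. 58 and Prop. 3.59.
* [Lee2012] J. M. Lee, *Introduction to Smooth Manifolds*, 2nd ed. (2012), Thm. 9.12 (the time-`t`
  maps of a global flow are diffeomorphisms).
-/

noncomputable section

-- `Summit.SmoothPoincare4.SmoothPoincare4.…` (summit = problem) trips `dupNamespace` on every decl.
set_option linter.dupNamespace false

open scoped Manifold ContDiff Topology
open MeasureTheory Set Filter Module Bundle Function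
open Literature.Geometry.Lorentzian Literature.Geometry.Riemannian Literature.Geometry.Manifold
open Literature.Geometry.Lorentzian.PseudoRiemannianMetric

namespace Summit.SmoothPoincare4.SmoothPoincare4.Theorems.NoncompactShrinkerGapNoncollapsing

variable {E : Type*} [NormedAddCommGroup E] [NormedSpace ℝ E] {H : Type*} [TopologicalSpace H]
  {I : ModelWithCorners ℝ E H} {M : Type*} [TopologicalSpace M] [ChartedSpace H M]

/-! ### Reparametrising an integral curve by `t ↦ -log (1 - t)` -/

/-- **Logarithmic time change of an integral curve.** If `γ` is a (global) integral curve of the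
vector field `V`, then `t ↦ γ(−log(1 − t))` is an integral curve, on the time set `(−∞, 1)`, of the
time-dependent vector field `(1 − t)⁻¹ V` (chain rule, `d/dt (−log(1 − t)) = (1 − t)⁻¹`): the time
change turning the gradient flow of the potential of a shrinking soliton into the diffeomorphisms
of its canonical Ricci flow (Naber 2010, Lemma 1.1; Chow–Lu–Ni 2006, proof of Thm. 4.1).
[cite: Naber2010, Lemma 1.1] -/
theorem isTimeDepMIntegralCurveOn_log_reparam {V : Π x : M, TangentSpace I x} {γ : ℝ → M}
    (hγ : IsMIntegralCurve γ V) :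
    IsTimeDepMIntegralCurveOn (fun t ↦ γ (-Real.log (1 - t))) (fun t x ↦ (1 - t)⁻¹ • V x)
      (Iio 1) := by
  intro t ht
  have ht' : (1 - t) ≠ 0 := (sub_pos.2 ht).ne'
  have hτ : HasDerivAt (fun s : ℝ ↦ -Real.log (1 - s)) ((1 - t)⁻¹) t := by
    have h1 : HasDerivAt (fun s : ℝ ↦ 1 - s) (-1) t := by
      simpa using (hasDerivAt_id t).const_sub 1
    exact (h1.log ht').neg.congr_deriv (by rw [neg_div, neg_neg, one_div])
  have hτm : HasMFDerivAt 𝓘(ℝ, ℝ) 𝓘(ℝ, ℝ) (fun s : ℝ ↦ -Real.log (1 - s)) t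
      ((1 : ℝ →L[ℝ] ℝ).smulRight ((1 - t)⁻¹ : ℝ)) :=
    hasMFDerivAt_iff_hasFDerivAt.2 hτ.hasFDerivAt
  have hcomp : ((1 : ℝ →L[ℝ] ℝ).smulRight (V (γ (-Real.log (1 - t))))).comp
      ((1 : ℝ →L[ℝ] ℝ).smulRight ((1 - t)⁻¹ : ℝ)) =
        (1 : ℝ →L[ℝ] ℝ).smulRight ((1 - t)⁻¹ • V (γ (-Real.log (1 - t)))) :=
    ContinuousLinearMap.smulRight_comp_smulRight 1 1
  exact ((hγ (-Real.log (1 - t))).comp t hτm).hasMFDerivWithinAt.congr_mfderiv hcomp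

/-! ### Time slices of a smooth global flow -/

/-- **The time-`c` map of a smooth global flow has injective differential everywhere**: by the
group law `θ_{-c} ∘ θ_c = θ_0 = id`, so `dθ_{-c} ∘ dθ_c = id` (chain rule). Lee 2012, Thm. 9.12
(each `θ_t` is a diffeomorphism with inverse `θ_{-t}`). [cite: Lee2012, Thm. 9.12] -/
theorem injective_mfderiv_flow_slice {θ : ℝ × M → M}
    (hθ : ContMDiff (𝓘(ℝ, ℝ).prod I) I ∞ θ) (h0 : ∀ p, θ (0, p) = p)
    (hadd : ∀ t s p, θ (t, θ (s, p)) = θ (t + s, p)) (c : ℝ) (u : M) :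
    Injective (mfderiv I I (fun x ↦ θ (c, x)) u) := by
  have hs : ∀ a : ℝ, ContMDiff I I ∞ (fun x ↦ θ (a, x)) := fun a ↦
    hθ.comp (contMDiff_const.prodMk contMDiff_id)
  have hd : ∀ (a : ℝ) (x : M), MDifferentiableAt I I (fun x ↦ θ (a, x)) x := fun a x ↦
    (hs a x).mdifferentiableAt (by simp)
  have hcomp : ((fun x ↦ θ (-c, x)) ∘ fun x ↦ θ (c, x)) = id := by
    funext x
    simp [hadd, h0]
  have key := mfderiv_comp u (hd (-c) (θ (c, u))) (hd c u)
  rw [hcomp, mfderiv_id] at key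
  refine Function.LeftInverse.injective (g := mfderiv I I (fun x ↦ θ (-c, x)) (θ (c, u))) fun v ↦ ?_
  have := DFunLike.congr_fun key v
  exact this.symm

/-- **`(x, t) ↦ θ(−log(1 − t), x)` is smooth on `M × (−∞, 1)`** for a jointly smooth `θ`
(`log` is smooth away from `0`). [folklore] -/
theorem contMDiffOn_flow_log {θ : ℝ × M → M} (hθ : ContMDiff (𝓘(ℝ, ℝ).prod I) I ∞ θ) :
    ContMDiffOn (I.prod 𝓘(ℝ, ℝ)) I ∞ (fun q : M × ℝ ↦ θ (-Real.log (1 - q.2), q.1))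
      (univ ×ˢ Iio 1) := by
  have hlog : ContDiffOn ℝ ∞ (fun s : ℝ ↦ -Real.log (1 - s)) (Iio 1) := by
    refine ContDiffOn.neg ?_
    refine Real.contDiffOn_log.comp (contDiff_const.sub contDiff_id).contDiffOn fun s hs ↦ ?_
    simp only [mem_compl_iff, mem_singleton_iff]
    exact (sub_pos.2 hs).ne'
  have h1 : ContMDiffOn (I.prod 𝓘(ℝ, ℝ)) 𝓘(ℝ, ℝ) ∞ (fun q : M × ℝ ↦ -Real.log (1 - q.2))
      (univ ×ˢ Iio 1) :=
    hlog.contMDiffOn.comp contMDiffOn_snd fun q hq ↦ hq.2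
  have h2 : ContMDiffOn (I.prod 𝓘(ℝ, ℝ)) (𝓘(ℝ, ℝ).prod I) ∞
      (fun q : M × ℝ ↦ ((-Real.log (1 - q.2), q.1) : ℝ × M)) (univ ×ˢ Iio 1) :=
    h1.prodMk contMDiffOn_fst
  exact hθ.comp_contMDiffOn h2

/-! ### The Lie derivative of the metric along a gradient field -/

section Gradient

variable [IsManifold I ∞ M] [FiniteDimensional ℝ E] [CompleteSpace E] [I.Boundaryless]
  (g : PseudoRiemannianMetric I ∞ E (TangentSpace I : M → Type _)) [g.HasLeviCivita]

/-- **`ℒ_{c ∇f} g = 2c Hess f`** through the Levi-Civita connection: for `f` smooth and a constant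
`c`, `g(∇_A (c ∇f), B) + g(A, ∇_B (c ∇f)) = 2c Hess f(A, B)` — `∇(c ∇f) = c ∇∇f`
(`IsCovariantDerivativeOn.smul_const`), `g(∇_A ∇f, B) = Hess f(A, B)`
(`val_leviCivita_grad_eq_hessian`) and the symmetry of the Hessian (`hessian_symm_holds`).
Topping 2006, §1.2.2 (`ℒ_X g = 2 Hess f` for `X = ∇f`, gradient solitons (1.2.4)–(1.2.5)).
[cite: Topping2006, §1.2.2] -/
theorem lieDerivMetric_smul_grad {f : M → ℝ} (hf : CMDiff ∞ f) (c : ℝ) (y : M)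
    (A B : TangentSpace I y) :
    lieDerivMetric g g.leviCivita (fun x ↦ c • grad g f x) y A B = 2 * c * g.hessian f y A B := by
  have h2 : (2 : ℕ∞ω) ≤ ∞ := WithTop.coe_le_coe.mpr le_top
  have hf2 : CMDiffAt 2 f y := (hf y).of_le h2
  have hgrad : MDiffAt (T% (grad g f)) y := ((contMDiff_grad g hf) y).mdifferentiableAt (by simp)
  have hsmul : g.leviCivita (fun x ↦ c • grad g f x) y = c • g.leviCivita (grad g f) y :=
    g.leviCivita.isCovariantDerivativeOn.smul_const (s := univ) c hgrad
  have hH : ∀ A' B' : TangentSpace I y,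
      g.val y (g.leviCivita (grad g f) y A') B' = g.hessian f y A' B' := fun A' B' ↦
    val_leviCivita_grad_eq_hessian g hf2 A' B'
  have hsym : g.hessian f y B A = g.hessian f y A B := (hessian_symm_holds (g := g) hf2).eq B A
  simp only [lieDerivMetric, hsmul, _root_.smul_apply, map_smul, smul_eq_mul]
  rw [g.symm y A, hH, hH, hsym]
  ring

end Gradient

/-! ### Pullbacks along local diffeomorphisms keep frame-wise curvature bounds -/

section Comap

variable [IsManifold I ∞ M]
  {E' : Type*} [NormedAddCommGroup E'] [NormedSpace ℝ E'] {H' : Type*} [TopologicalSpace H']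
  {I' : ModelWithCorners ℝ E' H'} {N : Type*} [TopologicalSpace N] [ChartedSpace H' N]
  [IsManifold I' ∞ N] [FiniteDimensional ℝ E] [FiniteDimensional ℝ E']
  [CompleteSpace E] [CompleteSpace E']
  (g : PseudoRiemannianMetric I ∞ E (TangentSpace I : M → Type _))
  {Φ : N → M} (hpb : contMDiff_pullbackBilin I M I' N ∞) (hΦ : ContMDiff I' I (∞ + 1) Φ)
  (hΦ' : ∀ u, Function.Injective (mfderiv I' I Φ u))
  (hdim : Module.finrank ℝ E' = Module.finrank ℝ E)

include hΦ' in
/-- **Frame-wise curvature bounds are preserved by pullback along local diffeomorphisms**: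
`Rm^{Φ^*g}(X, Y, Z, W) = Rm^g(dΦ X, dΦ Y, dΦ Z, dΦ W)` (naturality of the Riemann tensor, the
tree's `curvatureForm_comap_leviCivita`; O'Neill 1983, Ch. 3, Prop. 3.59) and `dΦ` maps
`Φ^*g`-unit vectors to `g`-unit vectors, so `|Rm^g| ≤ C ⇒ |Rm^{Φ^*g}| ≤ C` (`CurvatureBoundedBy`).
[cite: ONeill1983, Ch. 3, Prop. 3.59] -/
theorem curvatureBoundedBy_comap_leviCivita [g.HasLeviCivita]
    [(g.comap hpb Φ hΦ hΦ' hdim).HasLeviCivita] {C : ℝ} (h : CurvatureBoundedBy g g.leviCivita C) :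
    CurvatureBoundedBy (g.comap hpb Φ hΦ hΦ' hdim) (g.comap hpb Φ hΦ hΦ' hdim).leviCivita C :=
  fun u X Y Z W hX hY hZ hW ↦ by
  rw [g.curvatureForm_comap_leviCivita hpb hΦ hΦ' hdim u X Y Z W]
  exact h (Φ u) _ _ _ _ hX hY hZ hW

end Comap

/-! ### The canonical flow of a gradient shrinker along an abstract family `ψ` -/

section Flow

variable [IsManifold I ∞ M] [FiniteDimensional ℝ E] [CompleteSpace E] [I.Boundaryless]

/-- **The canonical Ricci flow of a gradient shrinking soliton, along an abstract family of maps**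
(Naber 2010, Lemma 1.1; Chow–Lu–Ni 2006, Thm. 4.1; Topping 2006, §1.2.2). Let `(M, g, f)` satisfy
`Ric + Hess f = g/2` (`g` Riemannian, `f` smooth) and let `ψ_t : M → M` be smooth local
diffeomorphisms, jointly smooth on `M × (−∞, 1)`, whose orbits `t ↦ ψ_t u` are integral curves of
the time-dependent field `X_t = (1 − t)⁻¹ ∇f` on `(−∞, 1)`. Then `G(t) = (1 − t) ψ_t^* g`
(extended by the junk value `ψ_t^* g` for `t ≥ 1`), with the Levi-Civita connections of
`ψ_t^* g`, is a Ricci flow on `(−∞, 1)` (`IsRicciFlow`): by Topping's Prop. 1.2.1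
(`hasDerivWithinAt_val_pullback_family`, constant family, `h = 0`),
`∂_t (ψ_t^* g) = ψ_t^*(ℒ_{X_t} g) = (1 − t)⁻¹ ψ_t^*(2 Hess f)`, so
`∂_t G = −ψ_t^* g + 2 ψ_t^* Hess f = −2 ψ_t^* Ric(g) = −2 Ric(G(t))` by the soliton equation,
naturality (`ricci_comap_apply`) and scale invariance of `Ric`; moreover `G(t)` is Riemannian,
`G(t)(v, w) = (1 − t) g(dψ_t v, dψ_t w)`, `G(0) = g` if `ψ_0 = id`, `Ric(G(t)) = ψ_t^* Ric(g)`,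
`R(G(t)) = (1 − t)⁻¹ R(g) ∘ ψ_t` (`scalarCurvature_comap`, `scalarCurvatureWith_constSmul`), and
the flow is of Type I: `|Rm_g| ≤ C ⇒ |Rm_{G(t)}| ≤ C/(1 − t)`
(`curvatureBoundedBy_comap_leviCivita`, `curvatureBoundedBy_constSmul_iff`).
[cite: Naber2010, Lemma 1.1] [cite: Topping2006, §1.2.2, Prop. 1.2.1] -/
theorem exists_isRicciFlow_shrinker_pullback
    (g : PseudoRiemannianMetric I ∞ E (TangentSpace I : M → Type _)) [g.HasLeviCivita]
    (f : M → ℝ) (hg : g.IsRiemannian) (hf : CMDiff ∞ f)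
    (hsol : ∀ (x : M) (X Y : TangentSpace I x),
      g.ricci x X Y + g.hessian f x X Y = (1 / 2 : ℝ) * g.val x X Y)
    (ψ : ℝ → M → M) (hψs : ∀ t, ContMDiff I I (∞ + 1) (ψ t))
    (hψi : ∀ t u, Injective (mfderiv I I (ψ t) u))
    (hψj : ContMDiffOn (I.prod 𝓘(ℝ, ℝ)) I ∞ (fun q : M × ℝ ↦ ψ q.2 q.1) (univ ×ˢ Iio 1))
    (hode : ∀ u, IsTimeDepMIntegralCurveOn (fun t ↦ ψ t u)
      (fun t x ↦ (1 - t)⁻¹ • grad g f x) (Iio 1)) :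
    ∃ (G : ℝ → PseudoRiemannianMetric I ∞ E (TangentSpace I : M → Type _))
      (cov : ℝ → CovariantDerivative I E (TangentSpace I : M → Type _)),
      IsRicciFlow G cov (Iio 1) ∧ (∀ t, t < 1 → (G t).IsRiemannian) ∧
      (∀ t, t < 1 → ∀ (u : M) (v w : TangentSpace I u), (G t).val u v w =
        (1 - t) * g.val (ψ t u) (mfderiv I I (ψ t) u v) (mfderiv I I (ψ t) u w)) ∧
      (ψ 0 = id → ∀ (u : M) (v w : TangentSpace I u), (G 0).val u v w = g.val u v w) ∧
      (∀ t, t < 1 → ∀ (u : M) (v w : TangentSpace I u), (cov t).ricci u v w =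
        g.ricci (ψ t u) (mfderiv I I (ψ t) u v) (mfderiv I I (ψ t) u w)) ∧
      (∀ t, t < 1 → ∀ u : M, (G t).scalarCurvatureWith (cov t) u =
        (1 - t)⁻¹ * g.scalarCurvature (ψ t u)) ∧
      ∀ C : ℝ, CurvatureBoundedBy g g.leviCivita C →
        ∀ t, t < 1 → CurvatureBoundedBy (G t) (cov t) (C / (1 - t)) := by
  have hdim : Module.finrank ℝ E = Module.finrank ℝ E := rfl
  have hpb : contMDiff_pullbackBilin I M I M ∞ := contMDiff_pullbackBilin_holds
  -- the pulled-back family `ψ_t^* g` and its Levi-Civita connections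
  set Gc : ℝ → PseudoRiemannianMetric I ∞ E (TangentSpace I : M → Type _) := fun t ↦
    g.comap hpb (ψ t) (hψs t) (hψi t) hdim
  set cov : ℝ → CovariantDerivative I E (TangentSpace I : M → Type _) := fun t ↦
    haveI := (Gc t).hasLeviCivita
    (Gc t).leviCivita
  have hLC : ∀ t, (Gc t).IsLeviCivita (cov t) := fun t ↦ by
    haveI := (Gc t).hasLeviCivita
    exact (Gc t).isLeviCivita_leviCivita_holds
  have hRic : ∀ (t : ℝ) (u : M) (v w : TangentSpace I u), (cov t).ricci u v w =
      g.ricci (ψ t u) (mfderiv I I (ψ t) u v) (mfderiv I I (ψ t) u w) := fun t u v w ↦ by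
    haveI := (Gc t).hasLeviCivita
    change (Gc t).ricci u v w = _
    exact g.ricci_comap_apply hpb (hψs t) (hψi t) hdim u v w
  -- the rescaled family `(1 - t) ψ_t^* g` (junk value `ψ_t^* g` for `t ≥ 1`)
  obtain ⟨G, hG⟩ : ∃ G : ℝ → PseudoRiemannianMetric I ∞ E (TangentSpace I : M → Type _),
      ∀ t (ht : t < 1), G t = (Gc t).constSmul (1 - t) (sub_pos.2 ht).ne' :=
    ⟨fun t ↦ if ht : t < 1 then (Gc t).constSmul (1 - t) (sub_pos.2 ht).ne' else Gc t,
      fun t ht ↦ dif_pos ht⟩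
  have hGval : ∀ t, t < 1 → ∀ (u : M) (v w : TangentSpace I u),
      (G t).val u v w = (1 - t) * (Gc t).val u v w := fun t ht u v w ↦ by
    rw [hG t ht, constSmul_apply]
  refine ⟨G, cov, ⟨?_, fun t ht ↦ ?_, fun t ht x A B ↦ ?_⟩, fun t ht ↦ ?_, hGval,
    fun hψ0 u v w ↦ ?_, fun t _ ↦ hRic t, fun t ht u ↦ ?_, fun C hC t ht ↦ ?_⟩
  · -- joint smoothness on `M × (-∞, 1)`
    have h1 : IsContMDiffFamilyOn ∞ Gc (Iio 1) :=
      (isContMDiffFamilyOn_const g (Iio 1)).pullbackBilin hψj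
    have hφ : ContDiffOn ℝ ∞ (fun t : ℝ ↦ 1 - t) (Iio 1) :=
      (contDiff_const.sub contDiff_id).contDiffOn
    refine (h1.smul hφ).congr ?_
    rintro ⟨x, t⟩ ⟨-, ht⟩
    simp only [hG t ht, val_constSmul]
  · -- Levi-Civita witnesses
    rw [hG t ht]
    exact (hLC t).constSmul _ _
  · -- the Ricci flow equation, by Topping's Prop. 1.2.1 for the constant family `g`
    have ht' : (1 - t) ≠ 0 := (sub_pos.2 ht).ne'
    have hXd : MDiffAt (T% (fun y ↦ (1 - t)⁻¹ • grad g f y)) (ψ t x) :=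
      (((contMDiff_grad g hf).const_smul_section (a := (1 - t)⁻¹)) (ψ t x)).mdifferentiableAt
        (by simp)
    have key : HasDerivWithinAt
        (fun s ↦ g.val (ψ s x) (mfderiv I I (ψ s) x A) (mfderiv I I (ψ s) x B))
        ((0 : ℝ) + lieDerivMetric g g.leviCivita (fun y ↦ (1 - t)⁻¹ • grad g f y) (ψ t x)
          (mfderiv I I (ψ t) x A) (mfderiv I I (ψ t) x B)) (Iio 1) t :=
      hasDerivWithinAt_val_pullback_family (N := M) (I' := I) (g := fun _ ↦ g)
        (cov := g.leviCivita) (X := fun s y ↦ (1 - s)⁻¹ • grad g f y) (ψ := ψ) (S := Iio 1)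
        (t₀ := t) (h := fun _ _ _ ↦ (0 : ℝ)) (isContMDiffFamilyOn_const g (Iio 1))
        (uniqueDiffOn_Iio 1) ht (by rw [interior_Iio]; exact subset_closure ht)
        (fun y A' B' ↦ hasDerivWithinAt_const t (Iio 1) (g.val y A' B'))
        g.isLeviCivita_leviCivita_holds hψj hode x hXd A B
    rw [lieDerivMetric_smul_grad g hf] at key
    have hprod := ((hasDerivWithinAt_id t (Iio 1)).const_sub 1).mul key
    have hsolt := hsol (ψ t x) (mfderiv I I (ψ t) x A) (mfderiv I I (ψ t) x B)
    have hval : -1 * g.val (ψ t x) (mfderiv I I (ψ t) x A) (mfderiv I I (ψ t) x B) +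
        (1 - t) * (0 + 2 * (1 - t)⁻¹ * g.hessian f (ψ t x) (mfderiv I I (ψ t) x A)
          (mfderiv I I (ψ t) x B)) = -2 * (cov t).ricci x A B := by
      rw [hRic]
      field_simp
      linarith
    refine (hprod.congr_of_eventuallyEq ?_ ?_).congr_deriv hval
    · filter_upwards [self_mem_nhdsWithin] with s hs
      exact hGval s hs x A B
    · exact hGval t ht x A B
  · -- Riemannian
    rw [hG t ht]
    exact (hg.comap hpb (hψs t) (hψi t) hdim).constSmul (sub_pos.2 ht)
  · -- initial value `ψ_0^* g = g`
    have h0 : (Gc 0).val = g.val := by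
      change pullbackBilin (I := I) (I' := I) (ψ 0) g.val = g.val
      rw [hψ0, pullbackBilin_id]
    rw [hGval 0 one_pos, h0, sub_zero, one_mul]
  · -- scalar curvature
    haveI := (Gc t).hasLeviCivita
    rw [hG t ht, scalarCurvatureWith_constSmul]
    congr 1
    change (Gc t).scalarCurvatureWith (Gc t).leviCivita u = _
    rw [scalarCurvatureWith_leviCivita]
    exact g.scalarCurvature_comap hpb (hψs t) (hψi t) hdim u
  · -- Type I curvature bound
    haveI := (Gc t).hasLeviCivita
    have hC' : (1 - t) * (C / (1 - t)) = C := by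
      rw [mul_comm, div_mul_cancel₀ C (sub_pos.2 ht).ne']
    rw [hG t ht, curvatureBoundedBy_constSmul_iff (Gc t) (cov t) (sub_pos.2 ht), hC']
    exact curvatureBoundedBy_comap_leviCivita g hpb (hψs t) (hψi t) hdim hC

end Flow

/-! ### The registered helper -/

/-- Registered helper `helper_shrinkerCanonicalFlow_of` (brick 3b of route item 16588's chain):
**the canonical ancient Type-I Ricci flow of a gradient shrinking soliton from its gradient flow**
(Naber 2010, Lemma 1.1; Chow–Lu–Ni 2006, Thm. 4.1; Topping 2006, §1.2.2). Given the shrinker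
`(Mⁿ, g, f)`, `Ric + Hess f = g/2`, and a smooth global flow `θ` of `∇f` (group law, orbits are
integral curves of `grad g f`), set `ψ_t = θ(−log(1 − t), ·)`; then `∂_t ψ_t = (1 − t)⁻¹ ∇f ∘ ψ_t`
on `(−∞, 1)` (`isTimeDepMIntegralCurveOn_log_reparam`), each `ψ_t` is a diffeomorphism
(`injective_mfderiv_flow_slice`), and `exists_isRicciFlow_shrinker_pullback` gives
`G(t) = (1 − t) ψ_t^* g`: a Ricci flow on `Iio 1`, Riemannian, with `G(0) = g` (`ψ_0 = θ_0 = id`),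
`Ric(G(t)) = ψ_t^* Ric(g)`, `R(G(t)) = (1 − t)⁻¹ R ∘ ψ_t`, `|Rm_{G(t)}| ≤ C/(1 − t)` if
`|Rm_g| ≤ C`. [cite: Naber2010, Lemma 1.1] [cite: Topping2006, §1.2.2, Prop. 1.2.1] -/
theorem helper_shrinkerCanonicalFlow_of : ∀ (n : ℕ) (M : Type) [TopologicalSpace M] [T2Space M] [SecondCountableTopology M] [ChartedSpace (EuclideanSpace ℝ (Fin n)) M] [IsManifold (𝓡 n) ∞ M] [ConnectedSpace M] [T3Space M] [MeasurableSpace M] [BorelSpace M] (g : PseudoRiemannianMetric (𝓡 n) ∞ (EuclideanSpace ℝ (Fin n)) (TangentSpace (𝓡 n) : M → Type _)) [g.HasLeviCivita] (f : M → ℝ) (hg : g.IsRiemannian), ContMDiff (𝓡 n) 𝓘(ℝ, ℝ) ∞ f → (∀ (x : M) (X Y : TangentSpace (𝓡 n) x), g.ricci x X Y + g.hessian f x X Y = (1 / 2 : ℝ) * g.val x X Y) → ∀ θ : ℝ × M → M, ContMDiff (𝓘(ℝ, ℝ).prod (𝓡 n)) (𝓡 n) ∞ θ → (∀ p, θ (0,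 p) = p) → (∀ t s p, θ (t, θ (s, p)) = θ (t + s, p)) → (∀ p, IsMIntegralCurve (fun t ↦ θ (t, p)) (Literature.Geometry.Riemannian.grad g f)) → ∃ (G : ℝ → PseudoRiemannianMetric (𝓡 n) ∞ (EuclideanSpace ℝ (Fin n)) (TangentSpace (𝓡 n) : M → Type _)) (cov : ℝ → CovariantDerivative (𝓡 n) (EuclideanSpace ℝ (Fin n)) (TangentSpace (𝓡 n) : M → Type _)), IsRicciFlow G cov (Set.Iio 1) ∧ (∀ t, t < 1 → (G t).IsRiemannian) ∧ (∀ t, t < 1 → ∀ (u : M) (v w : TangentSpace (𝓡 n) u), (G t).val u v w = (1 - t) * g.val (θ (-Real.log (1 - t), u)) (mfderiv (𝓡 n) (𝓡 n) (fun x ↦ θ (-Real.log (1 - t), x)) u v) (mfderiv (𝓡 n) (𝓡 n) (fun x ↦ θ (-Real.log (1 - t), x)) u w)) ∧ (∀ (u : M) (v w : TangentSpace (𝓡 n) u), (G 0).val u v w = g.val u v w) ∧ (∀ u : M, IsTimeDepMIntegralCurveOn (fun t ↦ θ (-Real.log (1 - t), u)) (fun t x ↦ (1 - t)⁻¹ •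 Literature.Geometry.Riemannian.grad g f x) (Set.Iio 1)) ∧ (∀ t, t < 1 → ∀ (u : M) (v w : TangentSpace (𝓡 n) u), (cov t).ricci u v w = g.ricci (θ (-Real.log (1 - t), u)) (mfderiv (𝓡 n) (𝓡 n) (fun x ↦ θ (-Real.log (1 - t), x)) u v) (mfderiv (𝓡 n) (𝓡 n) (fun x ↦ θ (-Real.log (1 - t), x)) u w)) ∧ (∀ t, t < 1 → ∀ u : M, (G t).scalarCurvatureWith (cov t) u = (1 - t)⁻¹ * g.scalarCurvature (θ (-Real.log (1 - t), u))) ∧ ∀ C : ℝ, CurvatureBoundedBy g g.leviCivita C → ∀ t, t < 1 → CurvatureBoundedBy (G t) (cov t) (C / (1 - t)) := by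
  intro n M _ _ _ _ _ _ _ _ _ g _ f hg hf hsol θ hθ hθ0 hθadd hint
  have hslice : ∀ c : ℝ, ContMDiff (𝓡 n) (𝓡 n) ∞ (fun x ↦ θ (c, x)) := fun c ↦
    hθ.comp (contMDiff_const.prodMk contMDiff_id)
  have hψs : ∀ t : ℝ, ContMDiff (𝓡 n) (𝓡 n) (∞ + 1) (fun x ↦ θ (-Real.log (1 - t), x)) :=
    fun t ↦ (hslice _).of_le (by exact_mod_cast le_top)
  obtain ⟨G, cov, hflow, hriem, hval, hinit, hric, hscal, htypeI⟩ :=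
    exists_isRicciFlow_shrinker_pullback (I := 𝓡 n) g f hg hf hsol
      (fun t x ↦ θ (-Real.log (1 - t), x)) hψs
      (fun t u ↦ injective_mfderiv_flow_slice hθ hθ0 hθadd _ u) (contMDiffOn_flow_log hθ)
      (fun u ↦ isTimeDepMIntegralCurveOn_log_reparam (hint u))
  -- initial value: `ψ_0 = θ_0 = id`
  have hψ0 : (fun x ↦ θ (-Real.log (1 - 0), x)) = id := by
    funext x
    simp [hθ0]
  exact ⟨G, cov, hflow, hriem, hval, hinit hψ0,
    fun u ↦ isTimeDepMIntegralCurveOn_log_reparam (hint u), hric, hscal, htypeI⟩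

end Summit.SmoothPoincare4.SmoothPoincare4.Theorems.NoncompactShrinkerGapNoncollapsing

end
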